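import Literature.IUT.HodgeArakelov.BadPrimeGaussianMonoidsGenuineRecordOrbitOfClassLevel

/-!
# [IUTchII] Cor 3.5 (ii) at the genuine `θ_env` data: `horb` / `hroots` from the [EtTh] inversion datum and the FUNCTION-LEVEL
# [EtTh] Prop 1.4 package on the theta function `Θ̈` (abc-iut-L2-t12's `ThetaKummerInput`) — END-TO-END form of row
# «COR35ii-HORB-GENUINE» (file 9, proof-only): NOTHING at the class level remains

S. Mochizuki, *Inter-universal Teichmüller theory II*, kurims Dec-2020 manuscript, Prop 2.2 (ii) p. 66, Cor 2.8 (i) p. 82, Prop 3.1 (i)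
p. 87, Cor 3.5 (ii) p. 95 [cite: Mochizuki2012, Prop 2.2 (ii) p.66]; [EtTh] Prop 1.4 (i)–(iii) pp. 20–22 («`Θ̈(Ü) = −Θ̈(Ü⁻¹)`;
`Θ̈(−Ü) = −Θ̈(Ü)`; `Θ̈(q^{a/2}Ü) = (−1)^a q^{−a²/2} Ü^{−2a} Θ̈(Ü)`»), Thm 1.6 (ii) p. 24, Def 2.5 (i) p. 39, Prop 2.2 (i) p. 37, Def 2.7
p. 41 (refereed). Claim key `Mochizuki2012` DISPUTED (D-0012). PROOF-ONLY companion (abc-iut cell, layer L6, seat abc-iut-w4-d004 gen 4;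
node **IUTchII:Cor3.5(ii)**). NO definition, NO `Prop` fact, NO instance; consumed BY NAME: abc-iut-w5-d125's three FUNCTION-level
suppliers `exists_sq_one_conj_etaDd_of_deck` (deck form of «`Θ̈(−Ü) = −Θ̈(Ü)`»), `autMap_comap_etaDd_eq_conj` («`Θ̈(Ü) = −Θ̈(Ü⁻¹)`» for the
pair) and `not_isOfFinOrder_comap_translate_of_kummer` (the translates «`Θ̈(q^{a/2}Ü) = …`»), abc-iut-w4-d010's bookkeeping
(`smul_inversionAlpha`, `exists_deck_element`) — i.e. EXACTLY the route of abc-iut-w4-d010's `prop22_ii'_model_of_thetaKummer'`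
(`ThetaEvaluationSettingModelAssembly2`, whose conclusion `Prop22_ii' Dec` hides the action) — and file 5's `rootLevel_inputs_of_classLevel`,
file 4's genuine theorems.

* `EtaleThetaDataOfSetting.rootLevel_inputs_of_thetaKummer` — the root-class-level (R2)(R3) triple (`hsign`, `hroot` for
  `inversionTransport`, `hfree`) FROM the inversion datum + the function-level package (binders VERBATIM those of
  `prop22_ii'_model_of_thetaKummer`).
* `EtaleLevels.horb_and_hroots_toRecord_inversion_of_thetaKummer` — the Cor 3.5 (ii) inputs `horb` AND `hroots` (one conjunction) at the
  genuine record (any inversion family whose `i₀`-th member is the limit action of `ι`), with the deck element `ε` ALSO discharged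
  (`exists_deck_element`).
RESIDUAL of `horb`/`hroots` after this file = {the [EtTh] inversion datum `ι` (`ι(Π^tp_{X̲̲}) = Π^tp_{X̲̲}`, theta companion, `ℤ`-reversal at a
`toLZ`-generator `γ`, `ι² = conj δ`, `ι ≡ +1` on `Δ_Θ/l·Δ_Θ`), the FUNCTION-level [EtTh] Prop 1.4 package on `ThetaKummerInput T` (`η̈^Θ = κ(Θ̈)`,
`hdeck`, `ιFn`/`hιFn`/`hΛ`/`hιθ`, the coordinate `Ü` with roots of its powers, the translate identity, `Λ(Fn) ≅ Δ_Θ` bijective, a ℚ-valued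
order function), `IsEtThOrigin` + a `CyclotomeTower` (or `mods`, file 7), bijective `c`, `μ ⊆ O`} — all L2-side / print-shaped; no
[IUTchII] §2/§3 hypothesis and nothing at the class level remains. HONEST FRAMING: composition of landed theorems; nothing disputed is
asserted; no side is taken on [IUTchIII] Cor 3.12; typed ≠ proved ≠ endorsed.
-/

noncomputable section

namespace Literature.IUT.HodgeArakelov

open Literature.AnabelianGeometry.EtaleTheta (ContH1 ThetaSetting RootSystem cyclotome)
open Literature.AnabelianGeometry.EtaleTheta
open EtaleThetaDataOfSetting CohomologySystemOfContH1

/-! ### §1. The root-class-level inputs from the FUNCTION-level [EtTh] Prop 1.4 package -/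

namespace EtaleThetaDataOfSetting

variable {p : ℕ} [Fact p.Prime] {D : Literature.AnabelianGeometry.EtaleTheta.ThetaSetting p}
  {E : D.EtaleThetaData} {l : ℕ} (C : E.DoubleUnderline l)
  (ι : D.PiTemp ≃ₜ* D.PiTemp) (hι : C.Huu.map ι.toMulEquiv.toMonoidHom = C.Huu) (c : ThetaSetting.ThetaCompanion ι)

/-- **(R2)(R3) at the root-class level FROM the FUNCTION-level [EtTh] Prop 1.4 package** (abc-iut-w5-d125's three suppliers through
file 5's `rootLevel_inputs_of_classLevel`; binders verbatim those of abc-iut-w4-d010's `prop22_ii'_model_of_thetaKummer`): the ε-sign,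
the `inversionTransport`-root statement and the non-torsion of the `γ`-translates for the chosen root class `η̲̈^Θ`.
[cite: MochizukiEtTh2009, Prop 1.4 (ii) p.22] -/
theorem rootLevel_inputs_of_thetaKummer [hN : (PiYdd C).Normal] [hYN : D.GtpYdd.Normal] (hS : D.Sec2Hyps)
    (hchar : PiYddCharacteristic C)
    (γ ε : Pi C) (hγ : C.toLZ γ = Multiplicative.ofAdd 1) (hε₁ : (ε : D.PiTemp) ∈ D.GtpY)
    (hε₂ : (ε : D.PiTemp) ∉ D.GtpYdd)
    (δ : Pi C) (hιι : ∀ x : Pi C, ι (ι (x : D.PiTemp)) = (δ : D.PiTemp) * (x : D.PiTemp) * (δ : D.PiTemp)⁻¹)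
    (hβ : ∀ a : D.GtpTheta, a ∈ D.DeltaTheta → c.thetaIso a * a⁻¹ ∈ D.lDeltaTheta l)
    -- (R2)(R3) the FUNCTION-level [EtTh] Prop. 1.4 package on t12's `ThetaKummerInput`
    (T : D.ThetaKummerInput) (hη : E.etaDd = T.kummerTheta)
    (hdeck : ∀ e' : D.PiTemp, e' ∈ D.GtpY → e' ∉ D.GtpYdd → e' • T.theta = T.const (-1) * T.theta)
    (ιFn : T.Fn →* T.Fn)
    (hιFn : ∀ (g : Pi C) (f : T.Fn), ιFn ((g : D.PiTemp) • f) = ι (g : D.PiTemp) • ιFn f)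
    (hΛ : ∀ ζ : cyclotome T.Fn, ContH1Aut.coeffMap D.DeltaTheta c.thetaIso (thetaCompanion_mem_deltaTheta ι c)
        (T.coeff.hom ζ) = T.coeff.hom (cyclotome.map ιFn ζ))
    (hιθ : ιFn T.theta = T.const (-1) * T.theta)
    {udd : T.Fn} (hu : udd ∈ MulAction.fixedPoints D.GtpYdd T.Fn) (xpow : ∀ m : ℤ, RootSystem (udd ^ m))
    (e : ℤ) (he : e ≠ 0)
    (hpow : ∀ k : ℤ, ∃ ck : (↥D.Kdd)ˣ, ((γ : D.PiTemp) ^ k) • T.theta = T.const ck * udd ^ (e * k) * T.theta)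
    (hΛbij : Function.Bijective T.coeff.hom)
    (ord : T.Fn →* Multiplicative ℚ) (hordc : ∀ ck, ord (T.const ck) = 1) (hordu : ord udd ≠ 1)
    {d : ℕ} (hd : 0 < d)
    (hint : ∀ f ∈ MulAction.fixedPoints ((PiYdd C ⊓ ⊤).map C.Huu.subtype) T.Fn,
      ∃ z : ℤ, Multiplicative.toAdd (ord f) = z / d) :
    (∃ κ : ContH1 (phi C) (D.lDeltaTheta l) (PiYdd C ⊓ ⊤), κ ^ 2 = 1 ∧
        ContH1.conj (phi C) (D.lDeltaTheta l) ε (rootLiftClass C) = rootLiftClass C * κ) ∧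
      (∃ τ₀ : Pi C, (τ₀ : D.PiTemp) ∈ D.GtpY ∧
        inversionTransport C ι hι c hchar (rootLiftClass C) = ContH1.conj (phi C) (D.lDeltaTheta l) τ₀ (rootLiftClass C)) ∧
      (∀ m n : ℤ, IsOfFinAddOrder
        ((h1Top C).symm (Additive.ofMul (ContH1.conj (phi C) (D.lDeltaTheta l) (γ ^ m) (rootLiftClass C))) -
          (h1Top C).symm (Additive.ofMul (ContH1.conj (phi C) (D.lDeltaTheta l) (γ ^ n) (rootLiftClass C)))) →
        m = n) :=
  rootLevel_inputs_of_classLevel C ι hι c hS hchar γ ε hγ hε₁ hε₂ δ hιι hβ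
    (E.exists_sq_one_conj_etaDd_of_deck T hdeck hη hε₁ hε₂)
    (E.autMap_comap_etaDd_eq_conj T hη (map_subtype_piYdd_inf_le_GtpYdd C ⊤) (inversionAlpha C ι hι)
      c.thetaIso (thetaCompanion_phi C ι hι c) (thetaCompanion_mem_deltaTheta ι c)
      (symm_mem_inf_top (PiYdd C) (inversionAlpha C ι hι) (mem_PiYdd_iff_of_piYddCharacteristic C hchar _))
      ιFn (smul_inversionAlpha C ι hι ιFn hιFn) hΛ hιθ hdeck ε hε₁ hε₂)
    (E.not_isOfFinOrder_comap_translate_of_kummer T hη hu xpow (γ : D.PiTemp) e he hpow hΛbij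
      (map_subtype_piYdd_inf_le_GtpYdd C ⊤) ord hordc hordu hd hint)

end EtaleThetaDataOfSetting

/-! ### §2. `horb` / `hroots` at the genuine data from the function-level package (deck element discharged) -/

namespace EtaleLevels

open TemperedThetaMonoids BadPrimeGaussianMonoids

variable {p : ℕ} [Fact p.Prime] {D : Literature.AnabelianGeometry.EtaleTheta.ThetaSetting p}
  {E : D.EtaleThetaData} {l : ℕ} (C : E.DoubleUnderline l) (hC : D.Compat) (hS : D.Sec2Hyps)
  (hl : l.Prime) (hp2 : p ≠ 2) (hpl : p ≠ l) (hζ : ∃ ζ : D.K, IsPrimitiveRoot ζ (4 * l))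
  (mods : ∀ M : ℕ+, D.CyclotomeMod l M)
  (f : contCocycles D.toTheta D.DeltaTheta C.GtpYdduu) (hf : f ∈ C.rootCocycles hC)
  (hmods : ∀ (M M' : ℕ+) (h : (M : ℕ) ∣ (M' : ℕ)) (x : D.lDeltaTheta l),
    MuN.red p M M' h ((mods M').red x) = (mods M).red x)
  (h15 : Literature.AnabelianGeometry.EtaleTheta.ThetaSetting.Prop15iii E hC) (L : C.CuspLabels)
  (hZ : ∀ M : ℕ+, Nonempty (ModelCyclotomes.lDeltaQuot (C.rigidData (mods M) hC hS h15 L) ≃*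
    Literature.IUT.HodgeTheaters.ZHat))
  (hcharY : EtaleThetaDataOfSetting.PiYddCharacteristic C)
  (hlim : Function.Bijective (rigidLimHom C hC hS hl hp2 hpl hζ mods f hf hmods h15 L hZ))
  [(EtaleThetaDataOfSetting.PiYdd C).Normal] [hYN : D.GtpYdd.Normal]
  (hO : D.IsEtThOrigin) {Es : Set ℕ+} (τc : D.CyclotomeTower l Es)
  -- the [EtTh] inversion datum
  (ι : D.PiTemp ≃ₜ* D.PiTemp) (hι : C.Huu.map ι.toMulEquiv.toMonoidHom = C.Huu) (cι : ThetaSetting.ThetaCompanion ι)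
  (γ : Pi C) (hγ : C.toLZ γ = Multiplicative.ofAdd 1) (hZι : D.toZ (ι (γ : D.PiTemp)) = (D.toZ (γ : D.PiTemp))⁻¹)
  (δ : Pi C) (hιι : ∀ x : Pi C, ι (ι (x : D.PiTemp)) = (δ : D.PiTemp) * (x : D.PiTemp) * (δ : D.PiTemp)⁻¹)
  (hβ : ∀ a : D.GtpTheta, a ∈ D.DeltaTheta → cι.thetaIso a * a⁻¹ ∈ D.lDeltaTheta l)
  -- the FUNCTION-level [EtTh] Prop 1.4 package
  (T : D.ThetaKummerInput) (hη : E.etaDd = T.kummerTheta)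
  (hdeck : ∀ e' : D.PiTemp, e' ∈ D.GtpY → e' ∉ D.GtpYdd → e' • T.theta = T.const (-1) * T.theta)
  (ιFn : T.Fn →* T.Fn)
  (hιFn : ∀ (g : Pi C) (f : T.Fn), ιFn ((g : D.PiTemp) • f) = ι (g : D.PiTemp) • ιFn f)
  (hΛ : ∀ ζ : cyclotome T.Fn, ContH1Aut.coeffMap D.DeltaTheta cι.thetaIso (thetaCompanion_mem_deltaTheta ι cι)
      (T.coeff.hom ζ) = T.coeff.hom (cyclotome.map ιFn ζ))
  (hιθ : ιFn T.theta = T.const (-1) * T.theta)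
  {udd : T.Fn} (hu : udd ∈ MulAction.fixedPoints D.GtpYdd T.Fn) (xpow : ∀ m : ℤ, RootSystem (udd ^ m))
  (e : ℤ) (he : e ≠ 0)
  (hpow : ∀ k : ℤ, ∃ ck : (↥D.Kdd)ˣ, ((γ : D.PiTemp) ^ k) • T.theta = T.const ck * udd ^ (e * k) * T.theta)
  (hΛbij : Function.Bijective T.coeff.hom)
  (ord : T.Fn →* Multiplicative ℚ) (hordc : ∀ ck, ord (T.const ck) = 1) (hordu : ord udd ≠ 1)
  {d : ℕ} (hd : 0 < d)
  (hint : ∀ f ∈ MulAction.fixedPoints ((PiYdd C ⊓ ⊤).map C.Huu.subtype) T.Fn,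
    ∃ z : ℤ, Multiplicative.toAdd (ord f) = z / d)
  {Iota : Type}
  (iota : Iota → ((thetaEnvData C hC hS hl hp2 hpl hζ mods f hf hmods h15 L hZ hcharY hlim).D.coh.lim ≃+
    (thetaEnvData C hC hS hl hp2 hpl hζ mods f hf hmods h15 L hZ hcharY hlim).D.coh.lim))
  {A : Type} [CommGroup A] [MulDistribMulAction (Pi C) A] [TopologicalSpace A] [RootableBy A ℕ]
  (c : CyclotomeCoefficients (phi C) (D.lDeltaTheta l) A)
  (hA : ∀ b : A, IsOpen (MulAction.stabilizer (Pi C) b : Set (Pi C)))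
  (hfi : ∀ b : A, (MulAction.stabilizer (Pi C) b).FiniteIndex)
  (O : Submonoid A)

include hS hO τc hγ hZι hιι hβ hη hdeck hιFn hΛ hιθ hu xpow he hpow hΛbij hordc hordu hd hint

/-- **The Cor 3.5 (ii) inputs `horb` AND `hroots` AT THE GENUINE RECORD — END-TO-END from the [EtTh] inversion datum and the
FUNCTION-level [EtTh] Prop 1.4 package** ([IUTchII] Cor 2.8 (i) p. 82 / Prop 3.1 (i) p. 87 / Prop 1.4 p. 27 / Cor 3.5 (ii) p. 95), as ONE
conjunction (the two conjuncts have the shapes of file 5's `horb_toRecord_inversion_of_classLevel` / `hroots_toRecord_inversion_of_classLevel`,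
whose class-level inputs are supplied here by `rootLevel_inputs_of_thetaKummer`; the deck element is discharged by `exists_deck_element`):
for ANY inversion family with `iota i₀ =` the limit action of `ι` and every `θ ∈ θ^{i₀}_env(𝕄_*)`, (a) `θ^{i₀}_env(𝕄_*)` is ONE `M^×_TM`-orbit
and (b) every `ϑ ∈ ∞θ^{i₀}_env(𝕄_*)` has a positive power in `M^×_TM · θ^ℕ`. Left: the datum, the package, `IsEtThOrigin` + `CyclotomeTower`,
bijective `c`, `μ ⊆ O`. [cite: Mochizuki2012, Cor 3.5 (ii) p.95] -/
theorem horb_and_hroots_toRecord_inversion_of_thetaKummer (hc : Function.Bijective c.hom)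
    (hOtors : ∀ a : A, IsOfFinOrder a → a ∈ O ∧ a⁻¹ ∈ O) {i₀ : Iota}
    (hi₀ : iota i₀ = pairRhoLim C (inversionAlpha C ι hι) cι.thetaIso (thetaCompanion_phi C ι hι cι)
      (mem_lDeltaTheta_iff_thetaCompanion ι cι l) (mem_PiYdd_iff_of_piYddCharacteristic C hcharY _))
    {θ : ((thetaEnvData C hC hS hl hp2 hpl hζ mods f hf hmods h15 L hZ hcharY hlim).toRecord
          (h1LimConjMulAut (phi C) (D.lDeltaTheta l) (PiYdd C))
          (h1LimKummerOn (phi C) (D.lDeltaTheta l) (PiYdd C) c hA hfi O) iota).H}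
    (hθ : θ ∈ ((thetaEnvData C hC hS hl hp2 hpl hζ mods f hf hmods h15 L hZ hcharY hlim).toRecord
          (h1LimConjMulAut (phi C) (D.lDeltaTheta l) (PiYdd C))
          (h1LimKummerOn (phi C) (D.lDeltaTheta l) (PiYdd C) c hA hfi O) iota).thetaEnv i₀) :
    (∀ θ' ∈ ((thetaEnvData C hC hS hl hp2 hpl hζ mods f hf hmods h15 L hZ hcharY hlim).toRecord
          (h1LimConjMulAut (phi C) (D.lDeltaTheta l) (PiYdd C))
          (h1LimKummerOn (phi C) (D.lDeltaTheta l) (PiYdd C) c hA hfi O) iota).thetaEnv i₀,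
      ∃ u ∈ ((thetaEnvData C hC hS hl hp2 hpl hζ mods f hf hmods h15 L hZ hcharY hlim).toRecord
          (h1LimConjMulAut (phi C) (D.lDeltaTheta l) (PiYdd C))
          (h1LimKummerOn (phi C) (D.lDeltaTheta l) (PiYdd C) c hA hfi O) iota).units, θ' = u * θ) ∧
    (∀ ϑ ∈ ((thetaEnvData C hC hS hl hp2 hpl hζ mods f hf hmods h15 L hZ hcharY hlim).toRecord
          (h1LimConjMulAut (phi C) (D.lDeltaTheta l) (PiYdd C))
          (h1LimKummerOn (phi C) (D.lDeltaTheta l) (PiYdd C) c hA hfi O) iota).inftyThetaEnv i₀,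
      ∃ N : ℕ, 0 < N ∧ ϑ ^ N ∈ splitMonoid ((thetaEnvData C hC hS hl hp2 hpl hζ mods f hf hmods h15 L hZ hcharY hlim).toRecord
          (h1LimConjMulAut (phi C) (D.lDeltaTheta l) (PiYdd C))
          (h1LimKummerOn (phi C) (D.lDeltaTheta l) (PiYdd C) c hA hfi O) iota).units (Submonoid.powers θ)) := by
  obtain ⟨ε, hε₁, hε₂⟩ := exists_deck_element C hS
  obtain ⟨hsign, hroot, hfree⟩ := rootLevel_inputs_of_thetaKummer C ι hι cι hS hcharY γ ε hγ hε₁ hε₂ δ hιι hβ T hη hdeck ιFn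
    hιFn hΛ hιθ hu xpow e he hpow hΛbij ord hordc hordu hd hint
  exact ⟨horb_toRecord_inversion C hC hS hl hp2 hpl hζ mods f hf hmods h15 L hZ hcharY hlim hO τc ι hι cι γ ε hγ hε₁ hε₂ hZι
      iota c hA hfi O hc hOtors hsign hroot hfree hi₀ hθ,
    hroots_toRecord_inversion C hC hS hl hp2 hpl hζ mods f hf hmods h15 L hZ hcharY hlim hO τc ι hι cι γ ε hγ hε₁ hε₂ hZι
      iota c hA hfi O hc hOtors hsign hroot hfree hi₀ hθ⟩

end EtaleLevels

end Literature.IUT.HodgeArakelov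

end
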